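import Summits.HodgeConjecture.HodgeConjecture.Theorems.PadicSemiregularLiftHodgeFermatVarietiesLevelRaise
import Summits.HodgeConjecture.HodgeConjecture.Theorems.PadicSemiregularLiftHodgeFermatVarietiesLevelRaiseSupply
import HarnessLib

/-!
# Stable reachability from the printed supply is invariant under the unit group `(ℤ/m)ˣ` — stub `stub_stableReach_unit_mul`, line `cancel-by-any-claim-lattice`, crux `HodgeFermatVarieties` (stmt-HodgeConjecture-1334)

STRUCTURAL HYGIENE for the residual engine stub S4 of the line. If a multiset `s` of `ℤ/m` is
stably ℤ-reachable from the printed supply (`StableReach[m, s]`: for some `k ≥ 1` there are finite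
families `P`, `N ⊆ Supply[km]` with `k • s + ΣN = ΣP` in `ℤ/km`, `k •` = level raising
`LevelRaise[k, m, ·]`, `a ↦ k⟨a⟩`), then so is `t • s = {t a : a ∈ s}` for every unit `t` of `ℤ/m`
(with `t = -1`: negation invariance). Hence S4 needs one representative per `(ℤ/m)ˣ`-orbit.

PROOF (everything PROVED here; arithmetic of `ℤ/M` only, no geometry). Lift `t` to a unit `T` of
`ℤ/km` (`ZMod.unitsMap_surjective`) and multiply the identity `k • s + ΣN = ΣP` by `T`:

* `T • (k • s) = k • (t • s)` (`levelRaise_map_unit_mul`, from the landed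
  `val_mul_levelRaise`: `⟨T · k⟨a⟩⟩_{km} = k ⟨t a⟩_m`);
* the printed supply `Supply[M]` is stable under every unit `T` of `ℤ/M` (`unit_mul_mem_supply`):
  pairs `{a, -a} ↦ {Ta, -(Ta)}`; Hodge multisets stay Hodge (`isHodgeMultiset_map_unit_mul`:
  `⟨t'(T a)⟩ = ⟨(t' T) a⟩` and Shioda's `Mₘ` is cut out by one equation per unit), cardinalities and
  zero-sum triples are kept (semi-decomposability); and Aoki's standard element
  `σ_{p,a} = {a + j d : j < p} + {-(p a)}` (`p` an odd prime dividing `M`, `d = M/p`) goes to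
  `σ_{p,Ta}` AS A MULTISET (`std_map_unit_mul`): the progression `{a + j d : j < p}` is the coset
  `a + ker(p ·)` of `ℤ/M` (`mem_prog_iff`: `x = a + j d` for some `j < p` iff `p x = p a`, since
  `ker(p ·) = {0, d, …, (p-1) d}`, `exists_eq_natCast_mul_div`), it is duplicate-free (`nodup_prog`),
  and multiplication by `T` maps the coset of `a` bijectively onto the coset of `Ta`
  (`prog_map_unit_mul`); `T (-(p a)) = -(p (T a))`; and the side condition is kept:
  `gcd(⟨Ta⟩, d) = gcd(⟨T⟩⟨a⟩, d) = gcd(⟨a⟩, d)` as `⟨T⟩` is prime to `M`, hence to `d`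
  (`gcd_val_unit_mul`).

This is the statement that the algebraic classes printed by the line are permuted by
`(ℤ/m)ˣ = Gal(ℚ(μₘ)/ℚ)` acting on characters (Shioda 1979 §1: `Mₘ` is defined by conditions over all
`t ∈ (ℤ/m)ˣ`; Aoki 1987 §1 p. 387: `𝔅ₘ` and the standard elements `σ_{p,i}` are `(ℤ/m)ˣ`-stable).

## References

* [Aoki1987] N. Aoki, Some new algebraic cycles on Fermat varieties, J. Math. Soc. Japan 39 (1987)
  385–396, §1 p. 387 (the standard elements `σ_{p,i}`, the `(ℤ/m)ˣ`-sets `𝔅ₘ`, `𝔖ₘ`).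
* [Shioda1979PJA] T. Shioda, The Hodge conjecture and the Tate conjecture for Fermat varieties,
  Proc. Japan Acad. 55A (1979) 111–114, §1 (the semigroup `Mₘ`, eqs. (2), (3)).
* [ShiodaKatsura1979] T. Shioda, T. Katsura, On Fermat varieties, Tôhoku Math. J. 31 (1979)
  97–115, §1.
-/

-- `HodgeConjecture.HodgeConjecture` repeats by the single-problem Summits layout (as in every sibling file).
set_option linter.dupNamespace false

noncomputable section

open Finset
open Literature.AlgebraicGeometry.HodgeTheory Literature.AlgebraicGeometry.HodgeTheory.FermatCharacter

namespace Summit.HodgeConjecture.HodgeConjecture.Theorems.CancelByAnyClaimLattice.UnitMul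

/-- `Supply[M]` — the printed supply of level `M` (local notation of the line, verbatim). -/
local notation3 (prettyPrint := false) "Supply[" M "]" =>
  ({s : Multiset (ZMod M) | ∃ a : ZMod M, a ≠ 0 ∧ s = ({a, -a} : Multiset (ZMod M))} ∪
    {s : Multiset (ZMod M) | IsHodgeMultiset s ∧ Multiset.card s = 4} ∪
    {s : Multiset (ZMod M) | IsHodgeMultiset s ∧ IsSemiDecomposable s} ∪
    {s : Multiset (ZMod M) | ∃ (p : ℕ) (a : ZMod M), p.Prime ∧ p ≠ 2 ∧ p ∣ M ∧
        2 < (M / p) / Nat.gcd (ZMod.val a) (M / p) ∧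
        s = Multiset.map (fun j : ℕ => a + (j : ZMod M) * ((M / p : ℕ) : ZMod M)) (Multiset.range p) +
              {-((p : ZMod M) * a)}} : Set (Multiset (ZMod M)))

/-- `Reach[M, s]` (local notation of the line, verbatim). -/
local notation3 (prettyPrint := false) "Reach[" M ", " s "]" =>
  ∃ P N : Multiset (Multiset (ZMod M)),
    (∀ u ∈ P, u ∈ Supply[M]) ∧ (∀ u ∈ N, u ∈ Supply[M]) ∧ s + Multiset.sum N = Multiset.sum P

/-- `LevelRaise[k, m, s]` (local notation of the line, verbatim). -/
local notation3 (prettyPrint := false) "LevelRaise[" k ", " m ", " s "]" =>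
  Multiset.map (fun a : ZMod m => ((k * ZMod.val a : ℕ) : ZMod (k * m))) s

/-- `StableReach[m, s]` (local notation of the line, verbatim). -/
local notation3 (prettyPrint := false) "StableReach[" m ", " s "]" => ∃ k : ℕ, 0 < k ∧ Reach[k * m, LevelRaise[k, m, s]]

/-- `Prog[N, p, b]` — the arithmetic progression `{b + j·(N/p) : j < p}` of Aoki's standard element
`σ_{p,b}` (local notation of this file only; verbatim the first summand of the fourth component of
`Supply[N]`). -/
local notation3 (prettyPrint := false) "Prog[" N ", " p ", " b "]" =>
  Multiset.map (fun j : ℕ => b + (j : ZMod N) * ((N / p : ℕ) : ZMod N)) (Multiset.range p)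

variable {M p : ℕ}

/-! ### §1 The progression of a standard element is a coset of `ker(p ·)`; units permute cosets -/

/-- `p · d = M = 0` in `ℤ/M` for `d = M/p`, `p ∣ M`. [folklore] -/
theorem natCast_p_mul_div (hpM : p ∣ M) : (p : ZMod M) * ((M / p : ℕ) : ZMod M) = 0 := by
  rw [← Nat.cast_mul, Nat.mul_div_cancel' hpM, ZMod.natCast_self]

/-- **The kernel of multiplication by `p` on `ℤ/M` (`p ∣ M`) is `{0, d, 2d, …, (p-1)d}`, `d = M/p`**:
`M = p d ∣ p⟨z⟩` forces `d ∣ ⟨z⟩ < p d`. [folklore] -/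
theorem exists_eq_natCast_mul_div [NeZero M] (hp : p.Prime) (hpM : p ∣ M) {z : ZMod M}
    (hz : (p : ZMod M) * z = 0) : ∃ i < p, z = (i : ZMod M) * ((M / p : ℕ) : ZMod M) := by
  have hpd : p * (M / p) = M := Nat.mul_div_cancel' hpM
  have hcast : (p : ZMod M) * z = ((p * z.val : ℕ) : ZMod M) := by
    rw [Nat.cast_mul, ZMod.natCast_zmod_val]
  rw [hcast, ZMod.natCast_eq_zero_iff] at hz
  have hz' : p * (M / p) ∣ p * z.val := by rw [hpd]; exact hz
  obtain ⟨i, hi⟩ := Nat.dvd_of_mul_dvd_mul_left hp.pos hz'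
  refine ⟨i, ?_, ?_⟩
  · have hlt : z.val < p * (M / p) := by rw [hpd]; exact ZMod.val_lt z
    rw [hi, mul_comm] at hlt
    exact Nat.lt_of_mul_lt_mul_right hlt
  · rw [← ZMod.natCast_zmod_val z, hi, Nat.cast_mul, mul_comm]

/-- **The progression `{a + j d : j < p}` is duplicate-free**: `⟨j d⟩ = j d` for `j < p` (as
`j d < p d = M`), and `d > 0`. [cite: Aoki1987, §1 p. 387 (definition of σ_{p,i})] -/
theorem nodup_prog [NeZero M] (hpM : p ∣ M) (a : ZMod M) : Multiset.Nodup (Prog[M, p, a]) := by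
  have hpd : p * (M / p) = M := Nat.mul_div_cancel' hpM
  have hd0 : 0 < M / p := Nat.pos_of_ne_zero fun h ↦ NeZero.ne M (by rw [← hpd, h, mul_zero])
  have hval : ∀ i < p, ((i : ZMod M) * ((M / p : ℕ) : ZMod M)).val = i * (M / p) := by
    intro i hi
    rw [← Nat.cast_mul, ZMod.val_natCast, Nat.mod_eq_of_lt]
    calc i * (M / p) < p * (M / p) := Nat.mul_lt_mul_of_pos_right hi hd0
      _ = M := hpd
  refine (Multiset.nodup_range p).map_on fun i hi j hj hij ↦ ?_
  have h := congrArg ZMod.val (add_left_cancel hij)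
  rw [hval i (Multiset.mem_range.mp hi), hval j (Multiset.mem_range.mp hj)] at h
  exact Nat.eq_of_mul_eq_mul_right hd0 h

/-- **`x` lies in the progression `{a + j d : j < p}` iff `p x = p a`** (the progression is the coset
`a + ker(p ·)`). [cite: Aoki1987, §1 p. 387 (definition of σ_{p,i})] -/
theorem mem_prog_iff [NeZero M] (hp : p.Prime) (hpM : p ∣ M) (a x : ZMod M) :
    x ∈ Prog[M, p, a] ↔ (p : ZMod M) * x = (p : ZMod M) * a := by
  rw [Multiset.mem_map]
  constructor
  · rintro ⟨i, -, rfl⟩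
    rw [mul_add, mul_left_comm, natCast_p_mul_div hpM, mul_zero, add_zero]
  · intro h
    have h0 : (p : ZMod M) * (x - a) = 0 := by rw [mul_sub, h, sub_self]
    obtain ⟨i, hi, hi'⟩ := exists_eq_natCast_mul_div hp hpM h0
    exact ⟨i, Multiset.mem_range.mpr hi, by rw [← hi', add_sub_cancel]⟩

/-- **Units permute the progressions**: `T · {a + j d : j < p} = {T a + j d : j < p}` as multisets —
both are duplicate-free, and `T` maps the coset `{x : p x = p a}` bijectively onto `{x : p x = p (T a)}`.
[cite: Aoki1987, §1 p. 387 (σ_{p,i}; 𝔅ₘ is a (ℤ/m)ˣ-set)] -/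
theorem prog_map_unit_mul [NeZero M] (hp : p.Prime) (hpM : p ∣ M) (T : (ZMod M)ˣ) (a : ZMod M) :
    (Prog[M, p, a]).map (fun x ↦ (T : ZMod M) * x) = Prog[M, p, (T : ZMod M) * a] := by
  apply (Multiset.Nodup.ext ((nodup_prog hpM a).map (Units.isUnit T).mul_right_injective)
    (nodup_prog hpM _)).mpr
  intro x
  rw [Multiset.mem_map, mem_prog_iff hp hpM]
  simp only [mem_prog_iff hp hpM]
  constructor
  · rintro ⟨y, hy, rfl⟩
    rw [mul_left_comm, hy, mul_left_comm]
  · intro hx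
    refine ⟨(T⁻¹ : (ZMod M)ˣ) * x, ?_, by rw [Units.mul_inv_cancel_left]⟩
    rw [mul_left_comm, hx, mul_left_comm, Units.inv_mul_cancel_left]

/-- **`T · σ_{p,a} = σ_{p,Ta}` as multisets** (`prog_map_unit_mul` and `T (-(p a)) = -(p (T a))`): the
standard elements of level `M` form a `(ℤ/M)ˣ`-set. [cite: Aoki1987, §1 p. 387] -/
theorem std_map_unit_mul [NeZero M] (hp : p.Prime) (hpM : p ∣ M) (T : (ZMod M)ˣ) (a : ZMod M) :
    (Prog[M, p, a] + {-((p : ZMod M) * a)}).map (fun x ↦ (T : ZMod M) * x) =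
      Prog[M, p, (T : ZMod M) * a] + {-((p : ZMod M) * ((T : ZMod M) * a))} := by
  rw [Multiset.map_add, Multiset.map_singleton, prog_map_unit_mul hp hpM, mul_neg, mul_left_comm]

/-- **The side condition is `(ℤ/M)ˣ`-invariant**: `gcd(⟨T a⟩, d) = gcd(⟨a⟩, d)` for `d ∣ M` and a unit
`T`, since `⟨T a⟩ ≡ ⟨T⟩⟨a⟩ (mod M)`, hence `(mod d)`, and `⟨T⟩` is prime to `M`, hence to `d`. [folklore] -/
theorem gcd_val_unit_mul [NeZero M] {d : ℕ} (hdM : d ∣ M) (T : (ZMod M)ˣ) (a : ZMod M) :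
    Nat.gcd ((T : ZMod M) * a).val d = Nat.gcd a.val d := by
  have hcop : Nat.Coprime (T : ZMod M).val d := (ZMod.val_coe_unit_coprime T).coprime_dvd_right hdM
  have h : ((T : ZMod M) * a).val ≡ (T : ZMod M).val * a.val [MOD d] := by
    rw [ZMod.val_mul]
    exact (Nat.mod_modEq _ _).of_dvd hdM
  rw [h.gcd_eq, hcop.gcd_mul_left_cancel]

/-! ### §2 The printed supply is stable under the unit group -/

/-- **A unit multiple of a Hodge multiset is a Hodge multiset**: `T a ≠ 0`, `Σ T a = T Σ a = 0`, and
`⟨t' (T a)⟩ = ⟨(t' T) a⟩` with `t' T` again a unit (Shioda's `Mₘ` is cut out by one equation (2) per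
unit). [cite: Shioda1979PJA, §1 eqs. (2), (3) (definition of `Mₘ`)] -/
theorem isHodgeMultiset_map_unit_mul {s : Multiset (ZMod M)} (hs : IsHodgeMultiset s) (T : (ZMod M)ˣ) :
    IsHodgeMultiset (s.map fun a ↦ (T : ZMod M) * a) := by
  refine ⟨⟨fun a ha ↦ ?_, ?_⟩, fun t' ↦ ?_⟩
  · obtain ⟨b, hb, rfl⟩ := Multiset.mem_map.1 ha
    exact (Units.mul_right_eq_zero T).not.mpr (hs.1.1 b hb)
  · rw [Multiset.sum_map_mul_left, Multiset.map_id', hs.1.2, mul_zero]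
  · have hf : ((fun a ↦ (t' : ZMod M) * a) ∘ fun a ↦ (T : ZMod M) * a) =
        fun a ↦ ((t' * T : (ZMod M)ˣ) : ZMod M) * a := by
      funext a
      simp only [Function.comp_apply, Units.val_mul, mul_assoc]
    rw [Multiset.map_map, Multiset.card_map, hf]
    exact hs.2 (t' * T)

/-- **The printed supply `Supply[M]` is stable under every unit `T` of `ℤ/M`**, componentwise: pairs
`{a, -a} ↦ {T a, -(T a)}`; Hodge `4`-multisets ↦ Hodge `4`-multisets; Hodge semi-decomposable sextuples
`t + u` ↦ `T t + T u` (zero-sum triples stay zero-sum); standard elements `σ_{p,a} ↦ σ_{p,Ta}`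
(`std_map_unit_mul`) with the same side condition (`gcd_val_unit_mul`).
[cite: Aoki1987, §1 p. 387 (𝔅ₘ, σ_{p,i})] [cite: Shioda1979PJA, §1 (Mₘ, Definition (iii))] -/
theorem unit_mul_mem_supply [NeZero M] (T : (ZMod M)ˣ) {u : Multiset (ZMod M)} (hu : u ∈ Supply[M]) :
    u.map (fun a ↦ (T : ZMod M) * a) ∈ Supply[M] := by
  simp only [Set.mem_union, Set.mem_setOf_eq] at hu ⊢
  rcases hu with ((⟨a, ha, rfl⟩ | ⟨hH, hc⟩) | ⟨hH, hsemi⟩) | ⟨p, a, hp, hp2, hpM, hside, rfl⟩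
  · -- pairs `{a, -a} ↦ {T a, -(T a)}`
    refine Or.inl (Or.inl (Or.inl ⟨(T : ZMod M) * a, (Units.mul_right_eq_zero T).not.mpr ha, ?_⟩))
    simp only [Multiset.insert_eq_cons, Multiset.map_cons, Multiset.map_singleton, mul_neg]
  · -- Hodge multisets with four elements
    exact Or.inl (Or.inl (Or.inr ⟨isHodgeMultiset_map_unit_mul hH T, by rw [Multiset.card_map, hc]⟩))
  · -- semi-decomposable Hodge sextuples
    obtain ⟨t, v, ht, hv, hts, hvs, rfl⟩ := hsemi
    refine Or.inl (Or.inr ⟨isHodgeMultiset_map_unit_mul hH T, ?_⟩)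
    refine ⟨t.map (fun a ↦ (T : ZMod M) * a), v.map (fun a ↦ (T : ZMod M) * a),
      by rw [Multiset.card_map, ht], by rw [Multiset.card_map, hv], ?_, ?_, Multiset.map_add _ _ _⟩
    · rw [Multiset.sum_map_mul_left, Multiset.map_id', hts, mul_zero]
    · rw [Multiset.sum_map_mul_left, Multiset.map_id', hvs, mul_zero]
  · -- standard elements `σ_{p,a} ↦ σ_{p,Ta}`
    refine Or.inr ⟨p, (T : ZMod M) * a, hp, hp2, hpM, ?_, std_map_unit_mul hp hpM T a⟩
    rw [gcd_val_unit_mul (Nat.div_dvd_of_dvd hpM) T a]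
    exact hside

/-! ### §3 Level raising intertwines the unit actions -/

/-- **`T • (k • s) = k • (t̄ • s)`** for a unit `T` of `ℤ/km` with image `t̄ ∈ (ℤ/m)ˣ`
(`ZMod.unitsMap`): entrywise `⟨T · k⟨a⟩⟩_{km} = k ⟨t̄ a⟩_m` (`val_mul_levelRaise`) `= ⟨k • (t̄ a)⟩_{km}`.
[cite: Aoki1987, §1 p. 387 (the elements g·σ)] -/
theorem levelRaise_map_unit_mul {k m : ℕ} [NeZero m] [NeZero (k * m)] (hk : 0 < k)
    (T : (ZMod (k * m))ˣ) (s : Multiset (ZMod m)) :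
    (LevelRaise[k, m, s]).map (fun b ↦ (T : ZMod (k * m)) * b) =
      LevelRaise[k, m, s.map (fun a ↦ ((ZMod.unitsMap (dvd_mul_left m k) T : (ZMod m)ˣ) : ZMod m) * a)] := by
  rw [Multiset.map_map, Multiset.map_map]
  refine Multiset.map_congr rfl fun a _ ↦ ?_
  simp only [Function.comp_apply]
  apply ZMod.val_injective (k * m)
  rw [val_mul_levelRaise, LevelRaiseSupply.val_levelRaise hk, coe_unitsMap_levelRaise]

/-! ### The stub -/

/-- **`stub_stableReach_unit_mul` — stable reachability from the printed supply is invariant under the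
unit group.** If `k • s + ΣN = ΣP` in `ℤ/km` with `P`, `N` finite families in `Supply[km]`, `k ≥ 1`,
then for every unit `t` of `ℤ/m`, lifting `t` to a unit `T` of `ℤ/km` (`ZMod.unitsMap_surjective`)
and multiplying by `T` gives `k • (t • s) + Σ(T • N) = Σ(T • P)` (`levelRaise_map_unit_mul`), and
`T • P`, `T • N ⊆ Supply[km]` (`unit_mul_mem_supply`): the printed supply — pairs, Hodge
`4`-multisets, Hodge semi-decomposable sextuples, Aoki's standard elements with their side
condition — is a `(ℤ/km)ˣ`-set. With `t = -1` this is negation invariance; for the engine stub S4 it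
means one representative per `(ℤ/m)ˣ`-orbit suffices.
[cite: Aoki1987, §1 p. 387 (𝔅ₘ and σ_{p,i} are (ℤ/m)ˣ-stable)] [cite: Shioda1979PJA, §1 (Mₘ)] -/
theorem stub_stableReach_unit_mul :
    ∀ (m : ℕ) [NeZero m] (t : (ZMod m)ˣ) (s : Multiset (ZMod m)), StableReach[m, s] → StableReach[m, s.map (fun a ↦ (t : ZMod m) * a)] := by
  intro m _ t s hs
  obtain ⟨k, hk, P, N, hP, hN, hsum⟩ := hs
  haveI : NeZero (k * m) := ⟨Nat.mul_ne_zero hk.ne' (NeZero.ne m)⟩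
  obtain ⟨T, rfl⟩ := ZMod.unitsMap_surjective (dvd_mul_left m k) t
  refine ⟨k, hk, P.map (Multiset.map fun b ↦ (T : ZMod (k * m)) * b),
    N.map (Multiset.map fun b ↦ (T : ZMod (k * m)) * b), ?_, ?_, ?_⟩
  · intro u hu
    obtain ⟨u', hu', rfl⟩ := Multiset.mem_map.1 hu
    exact unit_mul_mem_supply T (hP u' hu')
  · intro u hu
    obtain ⟨u', hu', rfl⟩ := Multiset.mem_map.1 hu
    exact unit_mul_mem_supply T (hN u' hu')
  · rw [← levelRaise_map_unit_mul hk T s, ← map_multiset_sum, ← map_multiset_sum, ← Multiset.map_add,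
      hsum]

end Summit.HodgeConjecture.HodgeConjecture.Theorems.CancelByAnyClaimLattice.UnitMul

end
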